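import Literature.Probability.RandomPlanarGeometry.YangBaxterSAWLaw
import Literature.Probability.RandomPlanarGeometry.YangBaxterSAWGrouping
import Literature.Probability.RandomPlanarGeometry.UnbasedLoopMeasurable
import Literature.Probability.Percolation.MedialPolygon
import Literature.Combinatorics.Enumerative.CyclicPairs
import HarnessLib

/-!
# Self-avoiding polygons of the Yang–Baxter walk and the critical polygon measure

Topic `Literature/Probability/RandomPlanarGeometry`; definition request `defn-YBPolygonMeasure`
(route `CriticalPhenomena/SAWScalingLimit/SAWTrackTransport`, to type its crux `PolygonTransport`,
"the full-plane (mirror-closed, endpoint-free) home of the track-transport coupling": a polygon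
has no endpoint mid-edge to be destroyed by a column exchange, so every column of the tiling is
exchangeable; cf. route `SAWLoopLift`, whose `δℤ²` polygon gas `ν_δ = Σ_P x_c^{|P|} δ_P` is the
square-lattice analogue).

`YangBaxterSAW.lean` / `YangBaxterSAWLaw.lean` vendor the *walks* of A. Glazman, I. Manolescu,
*Self-avoiding walk on `ℤ²` with Yang–Baxter weights: universality of critical fugacity and
2-point function*, Ann. Inst. Henri Poincaré Probab. Stat. 56 (2020), arXiv:1708.00395
(`GlazmanManolescu2019`), §1: the faces `Face = ℤ × ℤ` and mid-edges `MidEdge` of the columnar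
rhombic tiling with angle sequence `Θ : ℤ → ℝ`, its whole-plane embedding `planeMidpoint Θ`, the
walks `YBWalk D a z` (lists of mid-edges), the local weights `1, u₁, u₂, v, w₁, w₂` of eq. (1)
(`localWeight`) and the weight `w_Θ(γ) = ∏_faces localWeight`. The *closed* walks are not in
that paper (it treats "the case of null loop-weight", §3, p. 9), but they are the one-loop
configurations of the loop representation of the same integrable family: A. Glazman, *Connective
constant for a weighted self-avoiding walk on `ℤ²`*, ECP 20 (2015) (`Glazman2015WeightedSAW`), §5,
p. 11: "We consider a loop representation of the loop `O(n)` model on any finite simply connected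
rhombic tiling. The configuration in each rhombus is one of those mentioned in fig. 1 and we
consider only the configurations which can be decomposed into several loops. In this case the
weight of the configuration is `ω(conf) = Π_{rhombus r} ω(r) · n^{#loops}`, where `ω(r)` is the
weight of rhombus `r`, i.e. either `1` or one of `u₁, u₂, v, w₁, w₂`" (the `n = 0`, `s = −3/8`
member of the family (5.1)–(5.5) being the weights (1.1)–(1.5) = GM eq. (1)). The measure putting
mass `w(P)` on every single polygon `P` — the `n → 0` one-loop term — is, at `Θ ≡ π/3` where the
model "is just the loop `O(n)` model on the honeycomb lattice with the weight for each edge being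
equal to `1/√(2+√(2−n))`" (Glazman 2015, Remark 5.2), exactly "the discrete measure `μ^δ` on the
set of self-avoiding loops that one can draw on `δL`, that (for each `n`) puts a weight `λ^{-n}`
to each loop with `n` steps" of W. Werner, *The conformally invariant measure on self-avoiding
loops*, J. Amer. Math. Soc. 21 (2008), arXiv:math/0511605 (`Werner2008SelfAvoidingLoops`), §7.1
(after Lawler–Schramm–Werner; its conjectured scaling limit is a multiple of Werner's measure,
ibid. Conjecture 1).

## What is defined (namespace `Literature.Probability.RandomPlanarGeometry.SAW.YangBaxter`)

* complements on `Literature.Combinatorics.Enumerative.cycPairs` (the cyclically consecutive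
  pairs of a list, `CyclicPairs.lean`): `cycPairs_reverse` in order, membership under reversal.
* **`YBPolygon D`** — a ROOTED, ORIENTED self-avoiding polygon of the Yang–Baxter model in the
  domain `D : Set Face` (whole plane: `Set.univ`; a planar domain `Ω` at mesh `δ`:
  `meshFaces Θ Ω δ`): the cyclic list `mids = [z₀, …, zₙ₋₁]` of the mid-edges crossed, pairwise
  distinct, cyclically consecutive ones (the arcs `YBPolygon.arcs = cycPairs mids`, closing arc
  `zₙ₋₁ → z₀` included) two sides of a common rhombus of `D`, cyclically consecutive arcs in
  different rhombi, no rhombus carrying both straight arcs — the closed analogue of `YBWalk`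
  (`YBPolygon.toWalk` cuts it open at the root). `three_le_length`: `n ≥ 3`; the smallest
  polygons are the `plaquette`s around a vertex (`n = 4`; `Nonempty` instance).
* `YBPolygon.weight Θ P = w_Θ(P) = ∏_{faces} localWeight`, `YBPolygon.totalLength Θ P = |P|`,
  `YBPolygon.arcSet P : Finset (Sym2 MidEdge)` (the polygon as an unrooted unoriented object),
  `rotate` (change of root), `reverse` (change of orientation), `mapDomain`; the weight, length,
  arc set and trace are invariant under `rotate`/`reverse` (`weight_rotate`, `weight_reverse`, …).
* The drawing at mesh `δ`: `YBPolygon.points/path/curve Θ δ` (closed polyline through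
  `δ · planeMidpoint Θ zᵢ`, as for `YBWalk.curve`), `isLoop_curve`, `YBPolygon.basedLoop`,
  **`YBPolygon.loop Θ δ P : UnbasedLoop ℂ`** (root forgotten, orientation kept — DKKMO's loop
  space), `YBPolygon.trace` with `trace_eq_biUnion` (union of the drawn arcs), `trace_subset`
  (a polygon of `Ω_δ` is drawn in `Ω`).
* **The measures.** `YBPolygon.mass Θ x P = w_Θ(P) x^{|P|} / (2n)` and
  **`ybRootedPolygonMeasure Θ D x = Σ_P mass(P) δ_P`** on `YBPolygon D` (discrete σ-algebra):
  the polygon measure lifted to rooted oriented readings, each of the `2n` readings of a polygon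
  (`n` roots × 2 orientations) carrying an equal share; it is invariant under re-rooting and
  reversal (`map_rotate_ybRootedPolygonMeasure`, `map_reverse_ybRootedPolygonMeasure`).
  **`ybPolygonMeasure Θ D x : Measure (Finset (Sym2 MidEdge))`** `= map arcSet` of it is the
  polygon measure proper, `ν_{Θ,x} = Σ_P w_Θ(P) x^{|P|} δ_P`: **`ybPolygonMeasure_singleton_arcSet`**
  proves `ν {arcSet P} = w_Θ(P) x^{|P|}` (through `YBPolygon.arcSet_eq_iff`: two rooted oriented
  polygons have the same arc set iff they differ by a change of root and possibly a reversal, and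
  `card_readings`: there are exactly `2n` of them), and `ν` vanishes off arc sets of polygons
  (`ybPolygonMeasure_not_isYBPolygonArcSet`). Push-forwards to the plane at mesh `δ`:
  **`ybPolygonLoopMeasure Θ D x δ : Measure (UnbasedLoop ℂ)`** (mass `w/2` on each orientation of
  each drawn polygon) and `ybPolygonCurveMeasure Θ D x δ : Measure (CurveClass ℂ)` (rooted).
  The CRITICAL measure is `x = 1` ("the weights (1) may be considered critical", GM p. 3; at
  `Θ ≡ π/3`, `w_Θ(P) = x_c^{|P|}`, `x_c = 1/√(2+√2)`).
* Rooted normalisations: `YBPolygon.Surrounds Θ δ P S` (the drawn polygon surrounds the set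
  `S ⊆ ℂ`: `S` misses the trace and lies in bounded complementary components; root- and
  orientation-invariant), `ybPolygonLawOn Θ D x E` (`ν` conditioned on an event of rooted
  polygons, a probability measure when `0 < mass < ∞`, `isProbabilityMeasure_ybPolygonLawOn`) and
  **`ybPolygonLawAround Θ D x δ S`** = "the law of the polygon surrounding `S`" (a point `{z}`, a
  disc `Metric.closedBall c r`, …), invariant under re-rooting (`map_rotate_ybPolygonLawAround`).
  E.g. the law, on unbased loops, of the critical whole-plane polygon of constant angle `α`
  surrounding the closed unit disc at mesh `δ` is the term
  `(ybPolygonLawAround (fun _ => α) Set.univ 1 δ (Metric.closedBall 0 1)).map (YBPolygon.loop (fun _ => α) δ)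
    : Measure (UnbasedLoop ℂ)`
  (type-checked in the item's scratch file, together with a `PolygonTransport`-shaped comparison
  of these laws for `α` and `π/2` along `δ → 0⁺`).

## Design choices

* Rooted oriented lists are the primary objects (they are what column exchanges, cutting and
  drawing act on); unrooted polygons are DERIVED as arc sets, and unrooting is done by the measure
  (`mass = w/(2n)`, Lawler–Werner's "forgetting the root", `LawlerWerner2004` §4.1, as for the
  tree's `brownianLoopMeasure`), the count `2n` being a theorem (`card_readings`) rather than a
  convention. Conditioning the rooted measure on a root-invariant event therefore gives the law of a
  uniformly rooted, uniformly oriented reading of a `ν`-distributed polygon.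
* `UnbasedLoop ℂ` keeps the orientation (DKKMO compare oriented loops), so `ybPolygonLoopMeasure`
  charges both orientations of each polygon with `w/2` each; statements insensitive to orientation
  may use either this or `UnbasedLoop.reverse`-symmetrised events.
* "Surrounds" is phrased with bounded complementary components (Mathlib's `connectedComponentIn`,
  `Bornology.IsBounded`), as in route `SAWLoopLift`, not with winding numbers; for the simple closed
  polyline of a polygon the two agree (Jordan curve theorem, not in Mathlib), and
  `UnbasedLoop.wind` (`LoopWinding.lean`) is available on `YBPolygon.loop` if needed.
* Weights are clamped to `ℝ≥0∞` by `ENNReal.ofReal` as in `YangBaxterSAW(Law).lean` (no clamping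
  for `Θ k ∈ [π/3, 2π/3]`, `x ≥ 0`: `YBPolygon.weight_nonneg`); an edge fugacity `x` is kept (as in
  `ybWeight`/`ybLaw`) although the requests only need `x = 1`. Total masses are infinite for
  `D = Set.univ` (translation invariance in the vertical direction) — only conditioned /
  restricted versions are finite, and no finiteness is asserted here.
* Not here (not needed by the requests, or not Literature): the equality of the loops `(P.rotate k).loop = P.loop`
  in `UnbasedLoop ℂ` (true — a re-rooted closed polyline is a shifted reparametrisation — but not
  needed: all measures live on rooted polygons and traces are provably root-free, `trace_rotate`);
  Yang–Baxter / column-exchange invariance of `ν` (the content of `PolygonTransport`, routes'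
  business); the cutting identities to two-point functions beyond the map `toWalk`.
-/

noncomputable section

open MeasureTheory Filter Topology Real Literature.Probability.LatticeModels
open scoped ENNReal

namespace Literature.Probability.RandomPlanarGeometry.SAW.YangBaxter

open MidEdge
open Complex (I)
open _root_.Literature.Combinatorics.Enumerative

/-! ### Cyclic lists: complements on `Literature.Combinatorics.Enumerative.cycPairs` -/

section CycPairs

variable {α : Type*}

/-- Every entry is the first component of a cyclic pair. [folklore] -/
theorem exists_mem_cycPairs_fst_eq {l : List α} {x : α} (hx : x ∈ l) : ∃ p ∈ cycPairs l, p.1 = x := by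
  obtain ⟨i, hi, rfl⟩ := List.mem_iff_getElem.1 hx
  exact ⟨_, getElem_mem_cycPairs l i hi, rfl⟩

/-- Rotating a list permutes its cyclic pairs. [folklore] -/
theorem cycPairs_rotate_perm (l : List α) (k : ℕ) : (cycPairs (l.rotate k)).Perm (cycPairs l) := by
  rw [cycPairs_rotate]
  exact List.rotate_perm _ _

/-- The cyclic pairs of the reversed list are the swapped cyclic pairs: membership version.
[folklore] -/
theorem mem_cycPairs_reverse {l : List α} {p : α × α} :
    p ∈ cycPairs l.reverse ↔ p.swap ∈ cycPairs l := by
  rw [(cycPairs_reverse_perm l).mem_iff, List.mem_map]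
  constructor
  · rintro ⟨q, hq, rfl⟩
    simpa using hq
  · intro h
    exact ⟨p.swap, h, Prod.swap_swap p⟩

/-- The cyclic pairs of the reversed list, in order: the swapped pairs in the opposite cyclic
order, starting from the last one. [folklore] -/
theorem cycPairs_reverse (l : List α) :
    cycPairs l.reverse = (((cycPairs l).map Prod.swap).reverse).rotate 1 := by
  apply List.ext_getElem
  · simp
  · intro i h₁ h₂
    have hn : i < l.length := by simpa using h₁
    rw [getElem_cycPairs, List.getElem_rotate]
    simp only [List.getElem_reverse, List.getElem_map, List.length_reverse, List.length_map,
      length_cycPairs, getElem_cycPairs, Prod.swap_prod_mk, Prod.mk.injEq, and_true]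
    by_cases h : i + 1 < l.length
    · have e1 : (i + 1) % l.length = i + 1 := Nat.mod_eq_of_lt h
      have e2 : (l.length - 1 - (i + 1) + 1) % l.length = l.length - 1 - i := by
        rw [show l.length - 1 - (i + 1) + 1 = l.length - 1 - i by omega]
        exact Nat.mod_eq_of_lt (by omega)
      simp only [e1, e2]
    · have hi : i = l.length - 1 := by omega
      subst hi
      have e1 : (l.length - 1 + 1) % l.length = 0 := by
        rw [show l.length - 1 + 1 = l.length by omega, Nat.mod_self]
      have e2 : (l.length - 1 - 0 + 1) % l.length = 0 := by
        rw [Nat.sub_zero, show l.length - 1 + 1 = l.length by omega, Nat.mod_self]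
      simp only [e1, e2]
      congr 1; omega

end CycPairs

/-! ### Polygons (closed walks) of the Yang–Baxter model -/

/-- **A rooted, oriented self-avoiding polygon of the Yang–Baxter model** in the domain `D` (a set
of rhombi): a closed Glazman–Manolescu walk, recorded as the cyclic list `z₀, …, zₙ₋₁` of the
mid-edges it crosses, read from the root `z₀` in one of its two orientations — pairwise distinct
("crosses any edge at most once"), cyclically consecutive ones (including `zₙ₋₁, z₀`) two sides of
a common rhombus of `D` in which the arc between them is drawn, cyclically consecutive arcs in
different rhombi (every edge is crossed transversally), and no rhombus containing the two crossing
straight arcs (the local pictures are those of Glazman–Manolescu's Fig. 1). This is the closed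
analogue of `YBWalk`, i.e. the one-loop configuration of the loop representation of the `O(n)`
model on the rhombic tiling (Glazman 2015, §5: "The configuration in each rhombus is one of those
mentioned in fig. 1 and we consider only the configurations which can be decomposed into several
loops"), of which the weighted self-avoiding walk is the `n = 0` member. The smallest polygons
have `n = 4` mid-edges (around one vertex of the tiling); `n ≥ 3` is proved in `three_le_length`.
[cite: Glazman2015WeightedSAW, §5; GlazmanManolescu2019, §1 and Fig. 1] -/
@[ext] structure YBPolygon (D : Set Face) : Type where
  /-- the mid-edges `z₀, …, zₙ₋₁` crossed, in cyclic order from the root `z₀` -/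
  mids : List MidEdge
  /-- a polygon crosses at least one edge -/
  ne_nil : mids ≠ []
  /-- "crosses any edge at most once" -/
  nodup : mids.Nodup
  /-- each arc (cyclically consecutive pair) is drawn in a rhombus of the domain -/
  arc_mem : ∀ p ∈ cycPairs mids, ∃ f ∈ D, arcFace p = some f
  /-- cyclically consecutive arcs lie in different rhombi (the edge between them is crossed) -/
  chain : ∀ q ∈ cycPairs (cycPairs mids), arcFace q.1 ≠ arcFace q.2
  /-- the curve is simple: no rhombus contains both straight (crossing) arcs -/
  noncross : ∀ f : Face,
    ((f.side .W, f.side .E) ∈ cycPairs mids ∨ (f.side .E, f.side .W) ∈ cycPairs mids) →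
      ¬((f.side .S, f.side .N) ∈ cycPairs mids ∨ (f.side .N, f.side .S) ∈ cycPairs mids)

namespace YBPolygon

variable {D : Set Face}

/-- Discrete σ-algebra on the (countable) set of rooted polygons. [folklore] -/
instance : MeasurableSpace (YBPolygon D) := ⊤

/-- Every map out of the space of polygons is measurable (discrete σ-algebra). [folklore] -/
theorem measurable_of_top {β : Type*} [MeasurableSpace β] (f : YBPolygon D → β) : Measurable f :=
  fun _ _ => MeasurableSpace.measurableSet_top

/-- The arcs of the polygon: the cyclically consecutive pairs of mid-edges `(zᵢ, zᵢ₊₁)`,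
`(zₙ₋₁, z₀)` included. [cite: GlazmanManolescu2019, §1] -/
abbrev arcs (P : YBPolygon D) : List (MidEdge × MidEdge) := cycPairs P.mids

/-- The number `n` of mid-edges crossed (= the number of arcs). [folklore] -/
abbrev length (P : YBPolygon D) : ℕ := P.mids.length

/-- The root: the first mid-edge of the chosen cyclic reading. [folklore] -/
def root (P : YBPolygon D) : MidEdge := P.mids.head P.ne_nil

/-- The rhombi visited (containing at least one arc), as a finite set. [folklore] -/
def facesVisited (P : YBPolygon D) : Finset Face := (P.arcs.filterMap arcFace).toFinset

/-- The kinds of the arcs of `P` inside the rhombus `f` (a list of length `≤ 2`).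
[cite: GlazmanManolescu2019, Fig. 1] -/
def kindsIn (P : YBPolygon D) (f : Face) : List ArcKind := P.arcs.filterMap (kindF f)

/-- **The Yang–Baxter weight `w_Θ(P)` of a polygon**: the product over the rhombi of their local
weights `1, u₁, u₂, v, w₁, w₂` (eq. (1) of Glazman–Manolescu; rhombi without arcs contribute `1`),
i.e. the weight `Π_r ω(r)` of the one-loop configuration `P` in Glazman's loop representation
(the factor `n^{#loops} = n` being removed). [cite: Glazman2015WeightedSAW, §5; GlazmanManolescu2019, §1, eq. (1)] -/
def weight (Θ : ℤ → ℝ) (P : YBPolygon D) : ℝ :=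
  ∏ f ∈ P.facesVisited, localWeight (Θ f.1) (P.kindsIn f)

/-- **The length `|P|`** of a polygon: the sum of the lengths of its arcs (`3θ/π` for an arc
spanning an angle `θ`, `2` for a straight one), so that at `Θ ≡ π/3` it is the number of
hexagonal-lattice edges. [cite: GlazmanManolescu2019, §1 (before (4))] -/
def totalLength (Θ : ℤ → ℝ) (P : YBPolygon D) : ℝ :=
  (P.arcs.filterMap fun p =>
    (arcFace p).bind fun f => (arcKindOf p).map fun κ => arcLength (Θ f.1) κ).sum

/-- The polygon as an unrooted, unoriented combinatorial object: its set of arcs as unordered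
pairs of mid-edges (a polygon with `n` mid-edges has exactly `2n` rooted oriented readings, all
with this arc set). [folklore] -/
def arcSet (P : YBPolygon D) : Finset (Sym2 MidEdge) := (P.arcs.map fun p => s(p.1, p.2)).toFinset

/-! #### Elementary properties -/

/-- A polygon crosses at least one edge. [folklore] -/
theorem length_pos (P : YBPolygon D) : 0 < P.length := List.length_pos_iff.2 P.ne_nil

/-- An arc joins two distinct mid-edges. [folklore] -/
theorem ne_of_mem_arcs (P : YBPolygon D) {p : MidEdge × MidEdge} (hp : p ∈ P.arcs) : p.1 ≠ p.2 := by
  obtain ⟨f, -, hf⟩ := P.arc_mem p hp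
  exact (MidEdge.commonFace_eq_some hf).1

/-- **A polygon crosses at least three edges** (one or two mid-edges cannot close up transversally;
in fact the smallest polygons, around a vertex of the tiling, cross four). [folklore] -/
theorem three_le_length (P : YBPolygon D) : 3 ≤ P.length := by
  show 3 ≤ P.mids.length
  by_contra h
  have h0 : 0 < P.mids.length := P.length_pos
  have key : ∀ (i : ℕ) (hi : i < P.mids.length), P.mids[i] ≠ P.mids[(i + 1) % P.mids.length]'(Nat.mod_lt _ h0) :=
    fun i hi => P.ne_of_mem_arcs (getElem_mem_cycPairs P.mids i hi)
  rcases Nat.lt_or_ge P.mids.length 2 with h1 | h2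
  · -- one mid-edge: the only cyclic pair is `(z₀, z₀)`
    have hlen : P.mids.length = 1 := by omega
    have := key 0 h0
    simp only [hlen, Nat.zero_add, Nat.mod_self] at this
    exact this rfl
  · -- two mid-edges: the two arcs `(z₀, z₁)`, `(z₁, z₀)` lie in the same rhombus
    have hlen : P.mids.length = 2 := by omega
    have h01 : (P.mids[0]'h0, P.mids[1]'(by omega)) ∈ P.arcs :=
      mem_cycPairs_iff.2 ⟨0, h0, rfl, by simp [hlen]⟩
    have h10 : (P.mids[1]'(by omega), P.mids[0]'h0) ∈ P.arcs :=
      mem_cycPairs_iff.2 ⟨1, by omega, rfl, by simp [hlen]⟩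
    have hq : ((P.mids[0]'h0, P.mids[1]'(by omega)), (P.mids[1]'(by omega), P.mids[0]'h0)) ∈
        cycPairs P.arcs := by
      rw [mem_cycPairs_iff]
      obtain ⟨i, hi, he⟩ := List.mem_iff_getElem.1 h01
      refine ⟨i, by simpa using hi, he, ?_⟩
      have hlen' : P.arcs.length = 2 := by simp [hlen]
      obtain ⟨j, hj, he'⟩ := List.mem_iff_getElem.1 h10
      have hij : i ≠ j := by
        rintro rfl
        rw [he] at he'
        simp only [Prod.mk.injEq] at he'
        exact key 0 h0 (by simpa [hlen] using he'.1)
      have : (i + 1) % P.arcs.length = j := by rw [hlen']; omega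
      simp only [length_cycPairs] at this ⊢
      simp only [this, he']
    exact P.chain _ hq (by rw [arcFace_swap])

/-- Both ends of an arc are mid-edges of the polygon. [folklore] -/
theorem mem_mids_of_mem_arcs (P : YBPolygon D) {p : MidEdge × MidEdge} (hp : p ∈ P.arcs) :
    p.1 ∈ P.mids ∧ p.2 ∈ P.mids :=
  mem_of_mem_cycPairs hp

/-- A rhombus is visited iff it carries an arc. [folklore] -/
theorem mem_facesVisited_iff (P : YBPolygon D) {g : Face} :
    g ∈ P.facesVisited ↔ ∃ p ∈ P.arcs, arcFace p = some g := by
  simp [facesVisited, List.mem_filterMap]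

/-- Visited rhombi belong to the domain. [folklore] -/
theorem facesVisited_subset (P : YBPolygon D) : ↑P.facesVisited ⊆ D := by
  intro g hg
  obtain ⟨p, hp, hpg⟩ := P.mem_facesVisited_iff.1 hg
  obtain ⟨f, hf, hpf⟩ := P.arc_mem p hp
  rw [hpg] at hpf
  cases hpf
  exact hf

/-- A rhombus without arcs contributes the empty list of kinds. [folklore] -/
theorem kindsIn_eq_nil {P : YBPolygon D} {g : Face} (h : g ∉ P.facesVisited) : P.kindsIn g = [] := by
  rw [kindsIn, List.filterMap_eq_nil_iff]
  intro p hp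
  rw [mem_facesVisited_iff] at h
  exact kindF_of_ne fun hpg => h ⟨p, hp, hpg⟩

/-- The weight of a polygon is `≥ 0` when all angles are in `[π/3, 2π/3]`.
[cite: GlazmanManolescu2019, §1 ("the weights above are all non-negative if and only if θ ∈ [π/3, 2π/3]")] -/
theorem weight_nonneg (P : YBPolygon D) {Θ : ℤ → ℝ} (hΘ : ∀ k, Θ k ∈ Set.Icc (π / 3) (2 * π / 3)) :
    0 ≤ P.weight Θ :=
  Finset.prod_nonneg fun f _ => localWeight_nonneg (hΘ f.1) _

/-! #### Change of root, of orientation, of domain -/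

/-- **Re-rooting**: the same polygon read from its `k`-th mid-edge. [folklore] -/
def rotate (P : YBPolygon D) (k : ℕ) : YBPolygon D where
  mids := P.mids.rotate k
  ne_nil := by simpa using P.ne_nil
  nodup := List.nodup_rotate.2 P.nodup
  arc_mem p hp := P.arc_mem p (mem_cycPairs_rotate_iff.1 hp)
  chain q hq := P.chain q (by rwa [cycPairs_rotate, mem_cycPairs_rotate_iff] at hq)
  noncross f h := by
    simp only [mem_cycPairs_rotate_iff] at h ⊢
    exact P.noncross f h

/-- **Reversal**: the same polygon read in the opposite orientation (from its last mid-edge).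
[folklore] -/
def reverse (P : YBPolygon D) : YBPolygon D where
  mids := P.mids.reverse
  ne_nil := by simpa using P.ne_nil
  nodup := List.nodup_reverse.2 P.nodup
  arc_mem p hp := by
    obtain ⟨f, hf, hpf⟩ := P.arc_mem p.swap (mem_cycPairs_reverse.1 hp)
    refine ⟨f, hf, ?_⟩
    rw [show p.swap = (p.2, p.1) from rfl, arcFace_swap] at hpf
    exact hpf
  chain q hq := by
    have hq' : (q.2.swap, q.1.swap) ∈ cycPairs (cycPairs P.mids) := by
      rw [cycPairs_reverse, mem_cycPairs_rotate_iff, mem_cycPairs_reverse, cycPairs_map, List.mem_map] at hq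
      obtain ⟨r, hr, hrq⟩ := hq
      obtain ⟨r₁, r₂⟩ := r
      simp only [Prod.map_apply, Prod.swap, Prod.mk.injEq] at hrq
      obtain ⟨h1, h2⟩ := hrq
      rw [← h1, ← h2]
      simpa using hr
    have := P.chain _ hq'
    dsimp only at this
    simp only [Prod.swap] at this
    rw [arcFace_swap q.2.1 q.2.2, arcFace_swap q.1.1 q.1.2] at this
    exact this.symm
  noncross f h := by
    simp only [mem_cycPairs_reverse, Prod.swap_prod_mk] at h ⊢
    exact fun h' => P.noncross f (h.symm) (h'.symm)

/-- Restricting the domain: a polygon of `D ⊆ D'` is a polygon of `D'`. [folklore] -/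
def mapDomain {D D' : Set Face} (h : D ⊆ D') (P : YBPolygon D) : YBPolygon D' where
  mids := P.mids
  ne_nil := P.ne_nil
  nodup := P.nodup
  arc_mem p hp := by
    obtain ⟨f, hf, hpf⟩ := P.arc_mem p hp
    exact ⟨f, h hf, hpf⟩
  chain := P.chain
  noncross := P.noncross

/-- `mapDomain` is injective (the polygon is its list of mid-edges). [folklore] -/
theorem mapDomain_injective {D D' : Set Face} (h : D ⊆ D') :
    Function.Injective (mapDomain (D := D) h) := fun P Q hPQ => by
  have := congrArg YBPolygon.mids hPQ
  exact YBPolygon.ext this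

/-- The list of mid-edges of a re-rooted polygon. [folklore] -/
@[simp] theorem mids_rotate (P : YBPolygon D) (k : ℕ) : (P.rotate k).mids = P.mids.rotate k := rfl

/-- The list of mid-edges of a reversed polygon. [folklore] -/
@[simp] theorem mids_reverse (P : YBPolygon D) : P.reverse.mids = P.mids.reverse := rfl

/-- The list of mid-edges after a change of domain. [folklore] -/
@[simp] theorem mids_mapDomain {D D' : Set Face} (h : D ⊆ D') (P : YBPolygon D) : (P.mapDomain h).mids = P.mids := rfl

/-- Re-rooting does not change the number of mid-edges. [folklore] -/
@[simp] theorem length_rotate (P : YBPolygon D) (k : ℕ) : (P.rotate k).length = P.length := by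
  simp [length, rotate]

/-- Reversal does not change the number of mid-edges. [folklore] -/
@[simp] theorem length_reverse (P : YBPolygon D) : P.reverse.length = P.length := by
  simp [length, reverse]

/-- Re-rooting by `0` is the identity. [folklore] -/
@[simp] theorem rotate_zero (P : YBPolygon D) : P.rotate 0 = P := YBPolygon.ext (List.rotate_zero _)

/-- Re-rooting twice. [folklore] -/
theorem rotate_rotate (P : YBPolygon D) (k l : ℕ) : (P.rotate k).rotate l = P.rotate (k + l) :=
  YBPolygon.ext (List.rotate_rotate _ _ _)

/-- Re-rooting by the number of mid-edges is the identity. [folklore] -/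
@[simp] theorem rotate_length (P : YBPolygon D) : P.rotate P.length = P := YBPolygon.ext (List.rotate_length _)

/-- Reversal is an involution. [folklore] -/
@[simp] theorem reverse_reverse (P : YBPolygon D) : P.reverse.reverse = P := YBPolygon.ext (List.reverse_reverse _)

/-! #### The weight, the length and the arc set do not depend on the root and the orientation -/

/-- `arcFace` is a function of the unordered pair. [folklore] -/
theorem arcFace_comp_swap : (arcFace ∘ Prod.swap : MidEdge × MidEdge → Option Face) = arcFace :=
  funext fun p => arcFace_swap p.1 p.2

/-- `kindF g` is a function of the unordered pair. [folklore] -/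
theorem kindF_comp_swap (g : Face) : (kindF g ∘ Prod.swap : MidEdge × MidEdge → Option ArcKind) = kindF g :=
  funext fun p => kindF_swap g p.1 p.2

/-- Re-rooting does not change the visited rhombi. [folklore] -/
@[simp] theorem facesVisited_rotate (P : YBPolygon D) (k : ℕ) : (P.rotate k).facesVisited = P.facesVisited :=
  List.toFinset_eq_of_perm _ _ ((cycPairs_rotate_perm P.mids k).filterMap arcFace)

/-- Re-rooting permutes the kinds of the arcs in each rhombus. [folklore] -/
theorem kindsIn_rotate_perm (P : YBPolygon D) (k : ℕ) (g : Face) : ((P.rotate k).kindsIn g).Perm (P.kindsIn g) :=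
  (cycPairs_rotate_perm P.mids k).filterMap _

/-- **The weight does not depend on the root.** [folklore] -/
@[simp] theorem weight_rotate (Θ : ℤ → ℝ) (P : YBPolygon D) (k : ℕ) : (P.rotate k).weight Θ = P.weight Θ := by
  unfold weight
  rw [facesVisited_rotate]
  exact Finset.prod_congr rfl fun g _ => localWeight_perm _ (kindsIn_rotate_perm P k g)

/-- The length does not depend on the root. [folklore] -/
@[simp] theorem totalLength_rotate (Θ : ℤ → ℝ) (P : YBPolygon D) (k : ℕ) :
    (P.rotate k).totalLength Θ = P.totalLength Θ :=
  ((cycPairs_rotate_perm P.mids k).filterMap _).sum_eq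

/-- Reversal does not change the visited rhombi. [folklore] -/
@[simp] theorem facesVisited_reverse (P : YBPolygon D) : P.reverse.facesVisited = P.facesVisited := by
  apply List.toFinset_eq_of_perm
  have h := (cycPairs_reverse_perm P.mids).filterMap arcFace
  rwa [List.filterMap_map, arcFace_comp_swap] at h

/-- Reversal permutes the kinds of the arcs in each rhombus. [folklore] -/
theorem kindsIn_reverse_perm (P : YBPolygon D) (g : Face) : (P.reverse.kindsIn g).Perm (P.kindsIn g) := by
  have h := (cycPairs_reverse_perm P.mids).filterMap (kindF g)
  rwa [List.filterMap_map, kindF_comp_swap] at h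

/-- **The weight does not depend on the orientation.** [folklore] -/
@[simp] theorem weight_reverse (Θ : ℤ → ℝ) (P : YBPolygon D) : P.reverse.weight Θ = P.weight Θ := by
  unfold weight
  rw [facesVisited_reverse]
  exact Finset.prod_congr rfl fun g _ => localWeight_perm _ (kindsIn_reverse_perm P g)

/-- The length does not depend on the orientation. [folklore] -/
@[simp] theorem totalLength_reverse (Θ : ℤ → ℝ) (P : YBPolygon D) : P.reverse.totalLength Θ = P.totalLength Θ := by
  unfold totalLength
  have h := (cycPairs_reverse_perm P.mids).filterMap fun p =>
    (arcFace p).bind fun f => (arcKindOf p).map fun κ => arcLength (Θ f.1) κ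
  rw [List.filterMap_map] at h
  have hswap : ((fun p : MidEdge × MidEdge =>
      (arcFace p).bind fun f => (arcKindOf p).map fun κ => arcLength (Θ f.1) κ) ∘ Prod.swap) =
      fun p => (arcFace p).bind fun f => (arcKindOf p).map fun κ => arcLength (Θ f.1) κ := by
    funext p
    simp only [Function.comp_apply, Prod.swap, arcFace_swap p.1 p.2, arcKindOf_swap p.1 p.2]
  rw [hswap] at h
  exact h.sum_eq

/-- Changing the ambient domain does not change the weight. [folklore] -/
@[simp] theorem weight_mapDomain {D D' : Set Face} (h : D ⊆ D') (Θ : ℤ → ℝ) (P : YBPolygon D) :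
    (P.mapDomain h).weight Θ = P.weight Θ := rfl

/-- Changing the ambient domain does not change the length. [folklore] -/
@[simp] theorem totalLength_mapDomain {D D' : Set Face} (h : D ⊆ D') (Θ : ℤ → ℝ) (P : YBPolygon D) :
    (P.mapDomain h).totalLength Θ = P.totalLength Θ := rfl

/-- The arc set does not depend on the root. [folklore] -/
@[simp] theorem arcSet_rotate (P : YBPolygon D) (k : ℕ) : (P.rotate k).arcSet = P.arcSet :=
  List.toFinset_eq_of_perm _ _ ((cycPairs_rotate_perm P.mids k).map _)

/-- The arc set does not depend on the orientation. [folklore] -/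
@[simp] theorem arcSet_reverse (P : YBPolygon D) : P.reverse.arcSet = P.arcSet := by
  apply List.toFinset_eq_of_perm
  have h := (cycPairs_reverse_perm P.mids).map fun p : MidEdge × MidEdge => s(p.1, p.2)
  rw [List.map_map] at h
  have hswap : ((fun p : MidEdge × MidEdge => s(p.1, p.2)) ∘ Prod.swap) = fun p => s(p.1, p.2) := by
    funext p
    simp only [Function.comp_apply, Prod.swap]
    exact Sym2.eq_swap
  rwa [hswap] at h

/-! ### The polygon drawn in the plane -/

/-- The rescaled midpoints `δ · planeMidpoint Θ zᵢ` of the mid-edges crossed, in cyclic order from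
the root and back to it (`n + 1` points). [cite: GlazmanManolescu2019, §1] -/
def points (Θ : ℤ → ℝ) (δ : ℝ) (P : YBPolygon D) : List ℂ :=
  (P.mids ++ P.mids.take 1).map fun e => (δ : ℂ) * planeMidpoint Θ e

/-- **The polygon drawn at mesh `δ`**: the closed polyline through the rescaled midpoints of the
mid-edges it crosses, each segment inside the rescaled rhombus carrying the corresponding arc
(the paper draws smooth arcs meeting the edges perpendicularly; the two drawings are at uniform
distance `< 2δ`, cf. the design notes of `YangBaxterSAWLaw.lean`).
[cite: GlazmanManolescu2019, §1 ("a simple curve … intersecting edges at right angles")] -/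
def path (Θ : ℤ → ℝ) (δ : ℝ) (P : YBPolygon D) : C(unitInterval, ℂ) :=
  polyline (P.points Θ δ)

/-- The drawn polygon as a (based, oriented) random-curve sample point: its drawing at mesh `δ`
modulo reparametrisation, in `CurveClass ℂ`. [folklore] -/
def curve (Θ : ℤ → ℝ) (δ : ℝ) (P : YBPolygon D) : CurveClass ℂ :=
  CurveClass.mk ⟨P.path Θ δ⟩

/-- The trace of the drawn polygon. [folklore] -/
def trace (Θ : ℤ → ℝ) (δ : ℝ) (P : YBPolygon D) : Set ℂ :=
  Set.range (P.path Θ δ)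

/-- The list of drawn points, with the root split off. [folklore] -/
theorem points_eq (Θ : ℤ → ℝ) (δ : ℝ) (P : YBPolygon D) :
    P.points Θ δ = ((δ : ℂ) * planeMidpoint Θ P.root) ::
      ((P.mids.tail ++ [P.root]).map fun e => (δ : ℂ) * planeMidpoint Θ e) := by
  unfold points root
  obtain ⟨a, t, ht⟩ := List.exists_cons_of_ne_nil P.ne_nil
  simp only [ht, List.cons_append, List.take_succ_cons, List.take_zero, List.map_cons, List.head_cons,
    List.tail_cons]

/-- The drawn polygon starts at the rescaled midpoint of its root. [folklore] -/
theorem path_apply_zero (Θ : ℤ → ℝ) (δ : ℝ) (P : YBPolygon D) :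
    P.path Θ δ 0 = (δ : ℂ) * planeMidpoint Θ P.root := by
  rw [path, points_eq, polyline_apply_zero]

/-- The drawn polygon returns to the rescaled midpoint of its root. [folklore] -/
theorem path_apply_one (Θ : ℤ → ℝ) (δ : ℝ) (P : YBPolygon D) :
    P.path Θ δ 1 = (δ : ℂ) * planeMidpoint Θ P.root := by
  rw [path, points_eq, polyline_apply_one]
  simp

/-- **The drawn polygon is a loop.** [folklore] -/
theorem isLoop_curve (Θ : ℤ → ℝ) (δ : ℝ) (P : YBPolygon D) : (P.curve Θ δ).IsLoop := by
  rw [curve, CurveClass.isLoop_mk, Curve.isLoop_iff, Curve.source_def, Curve.target_def]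
  change P.path Θ δ 0 = P.path Θ δ 1
  rw [path_apply_zero, path_apply_one]

/-- The drawn polygon as a based loop (for the unbased loop distance of DKKMO). [folklore] -/
def basedLoop (Θ : ℤ → ℝ) (δ : ℝ) (P : YBPolygon D) : BasedLoop ℂ :=
  BasedLoop.mk (P.curve Θ δ) (P.isLoop_curve Θ δ)

/-- **The drawn polygon as an unbased oriented loop** (`UnbasedLoop ℂ`: closed curves modulo
orientation-preserving reparametrisation of the circle): the root is forgotten, the orientation is
kept. [folklore] -/
def loop (Θ : ℤ → ℝ) (δ : ℝ) (P : YBPolygon D) : UnbasedLoop ℂ :=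
  UnbasedLoop.mk (P.basedLoop Θ δ)

/-- The trace of the curve class is the trace of the drawing. [folklore] -/
@[simp] theorem range_curve (Θ : ℤ → ℝ) (δ : ℝ) (P : YBPolygon D) : (P.curve Θ δ).range = P.trace Θ δ := rfl

/-- The trace of the unbased loop is the trace of the drawing. [folklore] -/
@[simp] theorem range_loop (Θ : ℤ → ℝ) (δ : ℝ) (P : YBPolygon D) : (P.loop Θ δ).range = P.trace Θ δ := rfl

end YBPolygon

/-! #### The trace of a closed polyline -/

section Polyline

variable {E : Type*} [AddCommGroup E] [Module ℝ E] [TopologicalSpace E] [ContinuousAdd E]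
  [ContinuousSMul ℝ E]

/-- The trace of the closed polyline through `a :: l` and back to `a` is the union of the segments
between cyclically consecutive points. [folklore] -/
theorem range_polyline_closed (a : E) (l : List E) :
    Set.range (polyline (a :: (l ++ [a]))) = ⋃ p ∈ cycPairs (a :: l), segment ℝ p.1 p.2 := by
  change Set.range (polylineFrom a (l ++ [a])).2 = _
  rw [Literature.Probability.Percolation.range_polylineFrom_eq]
  have hz : (a :: (l ++ [a])).zip (l ++ [a]) = cycPairs (a :: l) := rfl
  rw [hz, Set.union_eq_right]
  intro x hx
  rw [Set.mem_singleton_iff.1 hx]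
  simp only [Set.mem_iUnion, exists_prop]
  obtain ⟨p, hp, hpa⟩ := exists_mem_cycPairs_fst_eq (List.mem_cons_self (a := a) (l := l))
  exact ⟨p, hp, hpa ▸ left_mem_segment _ _ _⟩

end Polyline

namespace YBPolygon

variable {D : Set Face}

/-- **The trace of the drawn polygon is the union of its drawn arcs** (the segments between the
rescaled midpoints of the two ends of each arc). [folklore] -/
theorem trace_eq_biUnion (Θ : ℤ → ℝ) (δ : ℝ) (P : YBPolygon D) :
    P.trace Θ δ = ⋃ p ∈ P.arcs, segment ℝ ((δ : ℂ) * planeMidpoint Θ p.1) ((δ : ℂ) * planeMidpoint Θ p.2) := by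
  obtain ⟨a, t, ht⟩ := List.exists_cons_of_ne_nil P.ne_nil
  unfold trace path points arcs
  rw [ht]
  have h1 : ((a :: t) ++ (a :: t).take 1).map (fun e => (δ : ℂ) * planeMidpoint Θ e) =
      ((δ : ℂ) * planeMidpoint Θ a) :: (t.map (fun e => (δ : ℂ) * planeMidpoint Θ e) ++
        [(δ : ℂ) * planeMidpoint Θ a]) := by simp
  have h2 : ((δ : ℂ) * planeMidpoint Θ a) :: t.map (fun e => (δ : ℂ) * planeMidpoint Θ e) =
      (a :: t).map (fun e => (δ : ℂ) * planeMidpoint Θ e) := rfl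
  rw [h1, range_polyline_closed, h2, cycPairs_map]
  simp only [List.mem_map, Set.iUnion_exists, Set.biUnion_and', Set.iUnion_iUnion_eq_right, Prod.map_fst,
    Prod.map_snd]

/-- The trace does not depend on the root. [folklore] -/
@[simp] theorem trace_rotate (Θ : ℤ → ℝ) (δ : ℝ) (P : YBPolygon D) (k : ℕ) :
    (P.rotate k).trace Θ δ = P.trace Θ δ := by
  simp only [trace_eq_biUnion, arcs, mids_rotate, mem_cycPairs_rotate_iff]

/-- The trace does not depend on the orientation. [folklore] -/
@[simp] theorem trace_reverse (Θ : ℤ → ℝ) (δ : ℝ) (P : YBPolygon D) : P.reverse.trace Θ δ = P.trace Θ δ := by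
  simp only [trace_eq_biUnion, arcs, mids_reverse, mem_cycPairs_reverse]
  apply subset_antisymm
  · intro x hx
    simp only [Set.mem_iUnion, exists_prop] at hx ⊢
    obtain ⟨p, hp, hx⟩ := hx
    exact ⟨p.swap, hp, by rw [segment_symm]; exact hx⟩
  · intro x hx
    simp only [Set.mem_iUnion, exists_prop] at hx ⊢
    obtain ⟨p, hp, hx⟩ := hx
    exact ⟨p.swap, by simpa using hp, by rw [segment_symm]; exact hx⟩

/-- The rescaled midpoint of every mid-edge crossed lies on the trace. [folklore] -/
theorem mem_trace (Θ : ℤ → ℝ) (δ : ℝ) (P : YBPolygon D) {e : MidEdge} (he : e ∈ P.mids) :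
    (δ : ℂ) * planeMidpoint Θ e ∈ P.trace Θ δ := by
  rw [trace_eq_biUnion]
  obtain ⟨p, hp, rfl⟩ := exists_mem_cycPairs_fst_eq he
  simp only [Set.mem_iUnion, exists_prop]
  exact ⟨p, hp, left_mem_segment _ _ _⟩

/-- **A polygon of `Ω_δ` is drawn inside `Ω`** (every arc is drawn in the closed rescaled rhombus
carrying it, which lies in `Ω`). [folklore] -/
theorem trace_subset {Θ : ℤ → ℝ} {Ω : Set ℂ} {δ : ℝ} (P : YBPolygon (meshFaces Θ Ω δ)) :
    P.trace Θ δ ⊆ Ω := by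
  rw [trace_eq_biUnion]
  exact Set.iUnion₂_subset fun p hp => segment_subset_of_arc_mem (P.arc_mem p hp)

end YBPolygon

/-! ### Countability -/

/-- There are countably many mid-edges. [folklore] -/
instance : Countable MidEdge := by
  classical
  refine Function.Injective.countable (f := fun e : MidEdge => match e with
    | .vert k j => (true, k, j)
    | .slant k j => (false, k, j)) ?_
  intro e e' h
  cases e <;> cases e' <;> simp_all

namespace YBPolygon

variable {D : Set Face}

/-- There are countably many rooted polygons (a polygon is its list of mid-edges). [folklore] -/
instance : Countable (YBPolygon D) :=
  Function.Injective.countable (f := YBPolygon.mids) fun _ _ h => YBPolygon.ext h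

/-! ### Re-rooting and reversal as bijections -/

/-- Re-rooting by `k` is a bijection of the set of rooted polygons (its inverse re-roots by
`n k - k`, `n` the number of mid-edges). [folklore] -/
def rotateEquiv (k : ℕ) : YBPolygon D ≃ YBPolygon D where
  toFun P := P.rotate k
  invFun P := P.rotate (P.length * k - k)
  left_inv P := by
    simp only [length_rotate, rotate_rotate]
    have h : k + (P.length * k - k) = P.length * k := by
      have := Nat.le_mul_of_pos_left k P.length_pos
      omega
    rw [h]
    exact YBPolygon.ext (List.rotate_length_mul _ _)
  right_inv P := by
    simp only [rotate_rotate]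
    have h : P.length * k - k + k = P.length * k := by
      have := Nat.le_mul_of_pos_left k P.length_pos
      omega
    rw [h]
    exact YBPolygon.ext (List.rotate_length_mul _ _)

/-- `rotateEquiv k` is re-rooting by `k`. [folklore] -/
@[simp] theorem rotateEquiv_apply (k : ℕ) (P : YBPolygon D) : rotateEquiv k P = P.rotate k := rfl

/-- Reversal is a bijection (an involution) of the set of rooted polygons. [folklore] -/
def reverseEquiv : YBPolygon D ≃ YBPolygon D :=
  Function.Involutive.toPerm YBPolygon.reverse YBPolygon.reverse_reverse

/-- `reverseEquiv` is reversal. [folklore] -/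
@[simp] theorem reverseEquiv_apply (P : YBPolygon D) : reverseEquiv P = P.reverse := rfl

/-! ### The mass of a rooted polygon -/

/-- **The mass of a rooted oriented polygon**: `w_Θ(P) x^{|P|} / (2n)`, `n` its number of
mid-edges — the weight of the polygon at edge fugacity `x` (`x = 1`: the critical weights (1) of
Glazman–Manolescu), shared equally between its `2n` rooted oriented readings (`n` roots, two
orientations), so that forgetting root and orientation produces the polygon measure
`ν(P) = w_Θ(P) x^{|P|}` (Lawler–Werner's passage from rooted to unrooted loops). Values are clamped
to `ℝ≥0∞` by `ENNReal.ofReal` (no clamping occurs for `Θ k ∈ [π/3, 2π/3]`, `x ≥ 0`).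
[cite: Glazman2015WeightedSAW, §5; LawlerWerner2004, §4.1] -/
def mass (Θ : ℤ → ℝ) (x : ℝ) (P : YBPolygon D) : ℝ≥0∞ :=
  ENNReal.ofReal (P.weight Θ * x ^ P.totalLength Θ) / (2 * (P.length : ℝ≥0∞))

/-- The mass does not depend on the root. [folklore] -/
@[simp] theorem mass_rotate (Θ : ℤ → ℝ) (x : ℝ) (P : YBPolygon D) (k : ℕ) : (P.rotate k).mass Θ x = P.mass Θ x := by
  simp [mass]

/-- The mass does not depend on the orientation. [folklore] -/
@[simp] theorem mass_reverse (Θ : ℤ → ℝ) (x : ℝ) (P : YBPolygon D) : P.reverse.mass Θ x = P.mass Θ x := by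
  simp [mass]

/-- The mass does not depend on the ambient domain. [folklore] -/
@[simp] theorem mass_mapDomain {D D' : Set Face} (h : D ⊆ D') (Θ : ℤ → ℝ) (x : ℝ) (P : YBPolygon D) :
    (P.mapDomain h).mass Θ x = P.mass Θ x := rfl

/-- The mass of a rooted polygon is finite. [folklore] -/
theorem mass_lt_top (Θ : ℤ → ℝ) (x : ℝ) (P : YBPolygon D) : P.mass Θ x < ⊤ :=
  ENNReal.div_lt_top ENNReal.ofReal_ne_top (by simpa using P.length_pos.ne')

/-- `2n` rooted readings of mass `w/(2n)` make up the weight `w`. [folklore] -/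
theorem two_mul_length_mul_mass (Θ : ℤ → ℝ) (x : ℝ) (P : YBPolygon D) :
    2 * (P.length : ℝ≥0∞) * P.mass Θ x = ENNReal.ofReal (P.weight Θ * x ^ P.totalLength Θ) := by
  rw [mass, ENNReal.mul_div_cancel]
  · simpa using P.length_pos.ne'
  · exact ENNReal.mul_ne_top (by simp) (ENNReal.natCast_ne_top _)

end YBPolygon

/-! ### The critical Yang–Baxter polygon measure -/

/-- **The Yang–Baxter polygon measure, on rooted oriented polygons.** The σ-finite (indeed purely
atomic) measure on the rooted oriented polygons of the domain `D` giving mass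
`w_Θ(P) x^{|P|} / (2n)` to each rooted oriented polygon with `n` mid-edges (`YBPolygon.mass`); it is
invariant under re-rooting and reversal (`map_rotate_ybRootedPolygonMeasure`,
`map_reverse_ybRootedPolygonMeasure`), and its image under forgetting root and orientation is the
polygon measure `ν_{Θ,x} = Σ_P w_Θ(P) x^{|P|} δ_P` (`ybPolygonMeasure`). At `x = 1` the weights are
the critical ones of Glazman–Manolescu (eq. (1); "the weights (1) may be considered critical",
p. 3), and at `Θ ≡ π/3`, `x = 1` this is the measure "that puts a weight `λ^{-n}` to each
[self-avoiding] loop with `n` steps" of the hexagonal lattice (Werner, §7.1, after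
Lawler–Schramm–Werner), `λ^{-1} = x_c = 1/√(2+√2)`. The whole-plane polygon gas of route
`SAWTrackTransport` is `D = Set.univ`; the gas of a planar domain `Ω` at mesh `δ` is
`D = meshFaces Θ Ω δ`.
[cite: Glazman2015WeightedSAW, §5; GlazmanManolescu2019, §1, eq. (1); Werner2008SelfAvoidingLoops, §7.1] -/
def ybRootedPolygonMeasure (Θ : ℤ → ℝ) (D : Set Face) (x : ℝ) : Measure (YBPolygon D) :=
  Measure.sum fun P : YBPolygon D => P.mass Θ x • Measure.dirac P

/-- A finite set of unordered pairs of mid-edges **is (the arc set of) a polygon** of `D`.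
[folklore] -/
def IsYBPolygonArcSet (D : Set Face) (A : Finset (Sym2 MidEdge)) : Prop :=
  ∃ P : YBPolygon D, P.arcSet = A

/-- **The Yang–Baxter polygon measure `ν_{Θ,x} = Σ_P w_Θ(P) x^{|P|} δ_P`** on (unrooted, unoriented)
polygons of `D`, a polygon being recorded by its set of arcs (unordered pairs of mid-edges lying
on a common rhombus; `IsYBPolygonArcSet`): the image of `ybRootedPolygonMeasure` under
`YBPolygon.arcSet`. Each polygon with `n` mid-edges has `2n` rooted oriented readings of mass
`w/(2n)` each. [cite: Glazman2015WeightedSAW, §5; Werner2008SelfAvoidingLoops, §7.1] -/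
def ybPolygonMeasure (Θ : ℤ → ℝ) (D : Set Face) (x : ℝ) : Measure (Finset (Sym2 MidEdge)) :=
  (ybRootedPolygonMeasure Θ D x).map YBPolygon.arcSet

/-- **The polygon measure pushed to unbased oriented loops of the plane at mesh `δ`**: the image of
`ybRootedPolygonMeasure` under `P ↦ P.loop Θ δ` (the closed polyline through the rescaled
midpoints `δ · planeMidpoint Θ zᵢ`, root forgotten, orientation kept — so each geometric polygon
carries mass `w/2` on each of its two orientations). This is the object compared across angle
sequences `Θ` in the track-transport programme (DKKMO's loop topology, `UnbasedLoop ℂ`).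
[cite: Glazman2015WeightedSAW, §5; Werner2008SelfAvoidingLoops, §7.1] -/
def ybPolygonLoopMeasure (Θ : ℤ → ℝ) (D : Set Face) (x δ : ℝ) : Measure (UnbasedLoop ℂ) :=
  (ybRootedPolygonMeasure Θ D x).map (YBPolygon.loop Θ δ)

/-- The polygon measure pushed to based curve classes at mesh `δ` (root and orientation kept: each
rooted oriented reading carries its mass `w/(2n)`). [folklore] -/
def ybPolygonCurveMeasure (Θ : ℤ → ℝ) (D : Set Face) (x δ : ℝ) : Measure (CurveClass ℂ) :=
  (ybRootedPolygonMeasure Θ D x).map (YBPolygon.curve Θ δ)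

namespace YBPolygon

variable {D : Set Face}

/-- **The drawn polygon surrounds the set `S`** (a point `{z}`, a disc, …): `S` does not meet the
trace and every point of `S` lies in a bounded connected component of the complement of the trace
(for the simple closed polyline of a polygon: `S` lies in its Jordan interior). [folklore] -/
def Surrounds (Θ : ℤ → ℝ) (δ : ℝ) (P : YBPolygon D) (S : Set ℂ) : Prop :=
  Disjoint S (P.trace Θ δ) ∧ ∀ z ∈ S, Bornology.IsBounded (connectedComponentIn (P.trace Θ δ)ᶜ z)

/-- Surrounding a set does not depend on the root. [folklore] -/
@[simp] theorem surrounds_rotate {Θ : ℤ → ℝ} {δ : ℝ} {P : YBPolygon D} {k : ℕ} {S : Set ℂ} :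
    (P.rotate k).Surrounds Θ δ S ↔ P.Surrounds Θ δ S := by
  simp only [Surrounds, trace_rotate]

/-- Surrounding a set does not depend on the orientation. [folklore] -/
@[simp] theorem surrounds_reverse {Θ : ℤ → ℝ} {δ : ℝ} {P : YBPolygon D} {S : Set ℂ} :
    P.reverse.Surrounds Θ δ S ↔ P.Surrounds Θ δ S := by
  simp only [Surrounds, trace_reverse]

/-- Surrounding is monotone in the surrounded set. [folklore] -/
theorem Surrounds.mono {Θ : ℤ → ℝ} {δ : ℝ} {P : YBPolygon D} {S T : Set ℂ} (h : P.Surrounds Θ δ T)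
    (hST : S ⊆ T) : P.Surrounds Θ δ S :=
  ⟨h.1.mono_left hST, fun z hz => h.2 z (hST hz)⟩

end YBPolygon

/-- **The polygon law conditioned on an event `E`** of rooted polygons: the normalised restriction
of `ybRootedPolygonMeasure` to `E` (junk value `0` if the mass of `E` is `0` or `∞`). For an event
invariant under re-rooting and reversal (such as `Surrounds`), this is the law of a uniformly
rooted, uniformly oriented reading of a polygon drawn from `ν_{Θ,x}( · | E)`. [folklore] -/
def ybPolygonLawOn (Θ : ℤ → ℝ) (D : Set Face) (x : ℝ) (E : Set (YBPolygon D)) : Measure (YBPolygon D) :=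
  (ybRootedPolygonMeasure Θ D x E)⁻¹ • (ybRootedPolygonMeasure Θ D x).restrict E

/-- **The law of the polygon surrounding `S`** ("polygons surrounding a given point / disc",
normalised): `ν_{Θ,x}` conditioned on the drawn polygon at mesh `δ` surrounding the set `S ⊆ ℂ`.
Push it to curves / loops with `Measure.map (YBPolygon.curve Θ δ)` / `(YBPolygon.loop Θ δ)`.
[folklore] -/
def ybPolygonLawAround (Θ : ℤ → ℝ) (D : Set Face) (x δ : ℝ) (S : Set ℂ) : Measure (YBPolygon D) :=
  ybPolygonLawOn Θ D x {P | P.Surrounds Θ δ S}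

/-! ### API: the measures -/

section Measures

variable {D : Set Face}

/-- The rooted polygon measure of a set is the sum of the masses of its elements. [folklore] -/
theorem ybRootedPolygonMeasure_apply (Θ : ℤ → ℝ) (x : ℝ) (s : Set (YBPolygon D)) :
    ybRootedPolygonMeasure Θ D x s = ∑' P, s.indicator (fun P => P.mass Θ x) P := by
  rw [ybRootedPolygonMeasure, Measure.sum_apply _ MeasurableSpace.measurableSet_top]
  refine tsum_congr fun P => ?_
  rw [Measure.smul_apply, Measure.dirac_apply' _ MeasurableSpace.measurableSet_top, smul_eq_mul]
  by_cases hP : P ∈ s <;> simp [hP]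

/-- The rooted polygon measure of a single rooted polygon is its mass `w x^{|P|}/(2n)`.
[folklore] -/
@[simp] theorem ybRootedPolygonMeasure_singleton (Θ : ℤ → ℝ) (x : ℝ) (P : YBPolygon D) :
    ybRootedPolygonMeasure Θ D x {P} = P.mass Θ x := by
  rw [ybRootedPolygonMeasure_apply, tsum_eq_single P]
  · simp
  · intro Q hQ
    simp [hQ]

/-- **The rooted polygon measure is invariant under re-rooting.** [folklore] -/
theorem map_rotate_ybRootedPolygonMeasure (Θ : ℤ → ℝ) (x : ℝ) (k : ℕ) :
    (ybRootedPolygonMeasure Θ D x).map (fun P => P.rotate k) = ybRootedPolygonMeasure Θ D x := by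
  ext s hs
  rw [Measure.map_apply (YBPolygon.measurable_of_top _) hs, ybRootedPolygonMeasure_apply,
    ybRootedPolygonMeasure_apply]
  have h : ∀ P : YBPolygon D, ((fun P => P.rotate k) ⁻¹' s).indicator (fun P => P.mass Θ x) P =
      s.indicator (fun P => P.mass Θ x) (YBPolygon.rotateEquiv k P) := by
    intro P
    rw [YBPolygon.rotateEquiv_apply]
    by_cases hP : P.rotate k ∈ s
    · rw [Set.indicator_of_mem hP, Set.indicator_of_mem (show P ∈ (fun P => P.rotate k) ⁻¹' s from hP),
        YBPolygon.mass_rotate]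
    · rw [Set.indicator_of_notMem hP, Set.indicator_of_notMem (show P ∉ (fun P => P.rotate k) ⁻¹' s from hP)]
  simp_rw [h]
  exact Equiv.tsum_eq (YBPolygon.rotateEquiv k) (s.indicator fun P => P.mass Θ x)

/-- **The rooted polygon measure is invariant under reversal.** [folklore] -/
theorem map_reverse_ybRootedPolygonMeasure (Θ : ℤ → ℝ) (x : ℝ) :
    (ybRootedPolygonMeasure Θ D x).map YBPolygon.reverse = ybRootedPolygonMeasure Θ D x := by
  ext s hs
  rw [Measure.map_apply (YBPolygon.measurable_of_top _) hs, ybRootedPolygonMeasure_apply,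
    ybRootedPolygonMeasure_apply]
  have h : ∀ P : YBPolygon D, (YBPolygon.reverse ⁻¹' s).indicator (fun P => P.mass Θ x) P =
      s.indicator (fun P => P.mass Θ x) (YBPolygon.reverseEquiv P) := by
    intro P
    rw [YBPolygon.reverseEquiv_apply]
    by_cases hP : P.reverse ∈ s
    · rw [Set.indicator_of_mem hP, Set.indicator_of_mem (show P ∈ YBPolygon.reverse ⁻¹' s from hP),
        YBPolygon.mass_reverse]
    · rw [Set.indicator_of_notMem hP, Set.indicator_of_notMem (show P ∉ YBPolygon.reverse ⁻¹' s from hP)]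
  simp_rw [h]
  exact Equiv.tsum_eq YBPolygon.reverseEquiv (s.indicator fun P => P.mass Θ x)

/-- An event invariant under re-rooting and reversal has the same mass after any change of root
or orientation of the sample. [folklore] -/
theorem ybRootedPolygonMeasure_preimage_rotate (Θ : ℤ → ℝ) (x : ℝ) (k : ℕ) (s : Set (YBPolygon D)) :
    ybRootedPolygonMeasure Θ D x ((fun P => P.rotate k) ⁻¹' s) = ybRootedPolygonMeasure Θ D x s := by
  conv_rhs => rw [← map_rotate_ybRootedPolygonMeasure Θ x k]
  rw [Measure.map_apply (YBPolygon.measurable_of_top _) MeasurableSpace.measurableSet_top]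

/-- The polygon measure of a (measurable) set of arc sets is the rooted measure of the rooted
polygons with arc set in it. [folklore] -/
theorem ybPolygonMeasure_apply (Θ : ℤ → ℝ) (x : ℝ) {S : Set (Finset (Sym2 MidEdge))} (hS : MeasurableSet S) :
    ybPolygonMeasure Θ D x S = ybRootedPolygonMeasure Θ D x (YBPolygon.arcSet ⁻¹' S) := by
  rw [ybPolygonMeasure, Measure.map_apply (YBPolygon.measurable_of_top _) hS]

/-- Each rooted reading contributes its mass to the polygon measure of its arc set. [folklore] -/
theorem mass_le_ybPolygonMeasure_singleton (Θ : ℤ → ℝ) (x : ℝ) (P : YBPolygon D) :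
    P.mass Θ x ≤ ybPolygonMeasure Θ D x {P.arcSet} := by
  rw [ybPolygonMeasure_apply Θ x (measurableSet_singleton _), ← ybRootedPolygonMeasure_singleton]
  exact measure_mono (Set.singleton_subset_iff.2 rfl)

/-- **The polygon measure is carried by arc sets of polygons.** [folklore] -/
theorem ybPolygonMeasure_not_isYBPolygonArcSet (Θ : ℤ → ℝ) (x : ℝ) :
    ybPolygonMeasure Θ D x {A | ¬IsYBPolygonArcSet D A} = 0 := by
  rw [ybPolygonMeasure_apply Θ x (Set.to_countable _).measurableSet]
  have h : YBPolygon.arcSet ⁻¹' {A | ¬IsYBPolygonArcSet D A} = (∅ : Set (YBPolygon D)) := by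
    ext P
    simp only [Set.mem_preimage, Set.mem_setOf_eq, IsYBPolygonArcSet, not_exists, Set.mem_empty_iff_false,
      iff_false, not_forall, not_not]
    exact ⟨P, rfl⟩
  rw [h, measure_empty]

/-- The loop measure of a Borel set of unbased loops is the rooted measure of the rooted polygons
drawn in it. [folklore] -/
theorem ybPolygonLoopMeasure_apply (Θ : ℤ → ℝ) (x δ : ℝ) {S : Set (UnbasedLoop ℂ)} (hS : MeasurableSet S) :
    ybPolygonLoopMeasure Θ D x δ S = ybRootedPolygonMeasure Θ D x (YBPolygon.loop Θ δ ⁻¹' S) := by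
  rw [ybPolygonLoopMeasure, Measure.map_apply (YBPolygon.measurable_of_top _) hS]

/-- The curve measure of a Borel set of curve classes is the rooted measure of the rooted polygons
drawn in it. [folklore] -/
theorem ybPolygonCurveMeasure_apply (Θ : ℤ → ℝ) (x δ : ℝ) {S : Set (CurveClass ℂ)} (hS : MeasurableSet S) :
    ybPolygonCurveMeasure Θ D x δ S = ybRootedPolygonMeasure Θ D x (YBPolygon.curve Θ δ ⁻¹' S) := by
  rw [ybPolygonCurveMeasure, Measure.map_apply (YBPolygon.measurable_of_top _) hS]

/-- When the conditioning event has mass neither `0` nor `∞`, the conditioned polygon law is a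
probability measure. [folklore] -/
theorem isProbabilityMeasure_ybPolygonLawOn {Θ : ℤ → ℝ} {x : ℝ} {E : Set (YBPolygon D)}
    (h0 : ybRootedPolygonMeasure Θ D x E ≠ 0) (htop : ybRootedPolygonMeasure Θ D x E ≠ ⊤) :
    IsProbabilityMeasure (ybPolygonLawOn Θ D x E) :=
  ⟨by rw [ybPolygonLawOn, Measure.smul_apply, Measure.restrict_apply_univ, smul_eq_mul,
    ENNReal.inv_mul_cancel h0 htop]⟩

/-- The conditioned law is carried by the conditioning event. [folklore] -/
theorem ybPolygonLawOn_compl (Θ : ℤ → ℝ) (x : ℝ) (E : Set (YBPolygon D)) : ybPolygonLawOn Θ D x E Eᶜ = 0 := by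
  rw [ybPolygonLawOn, Measure.smul_apply, Measure.restrict_apply MeasurableSpace.measurableSet_top,
    Set.compl_inter_self, measure_empty, smul_zero]

/-- **The law of the polygon surrounding `S` is invariant under re-rooting** (it is the law of a
uniformly rooted reading of an unrooted polygon). [folklore] -/
theorem map_rotate_ybPolygonLawAround (Θ : ℤ → ℝ) (x δ : ℝ) (S : Set ℂ) (k : ℕ) :
    (ybPolygonLawAround Θ D x δ S).map (fun P => P.rotate k) = ybPolygonLawAround Θ D x δ S := by
  ext s hs
  rw [Measure.map_apply (YBPolygon.measurable_of_top _) hs, ybPolygonLawAround, ybPolygonLawOn,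
    Measure.smul_apply, Measure.smul_apply, Measure.restrict_apply MeasurableSpace.measurableSet_top,
    Measure.restrict_apply MeasurableSpace.measurableSet_top]
  congr 1
  have h : (fun P : YBPolygon D => P.rotate k) ⁻¹' s ∩ {P | P.Surrounds Θ δ S} =
      (fun P : YBPolygon D => P.rotate k) ⁻¹' (s ∩ {P | P.Surrounds Θ δ S}) := by
    ext P
    simp only [Set.mem_inter_iff, Set.mem_preimage, Set.mem_setOf_eq, YBPolygon.surrounds_rotate]
  rw [h, ybRootedPolygonMeasure_preimage_rotate]

end Measures

/-! ### Non-vacuity: the polygon around a vertex -/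

section Plaquette

/-- The cyclic pairs of a four-element list. [folklore] -/
theorem cycPairs_four {α : Type*} (a b c d : α) : cycPairs [a, b, c, d] = [(a, b), (b, c), (c, d), (d, a)] := rfl

/-- The arc from the East to the South side of the rhombus `(k - 1, j)`. [folklore] -/
theorem arcFace_vert_slant_left (k j : ℤ) : arcFace (.vert k j, .slant (k - 1) j) = some (k - 1, j) := by
  have h : (MidEdge.vert k j, MidEdge.slant (k - 1) j) = (Face.side (k - 1, j) .E, Face.side (k - 1, j) .S) := by
    simp [Face.side]
  rw [h]
  exact arcFace_side_side _ _ _ (by decide)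

/-- The arc from the North to the East side of the rhombus `(k - 1, j - 1)`. [folklore] -/
theorem arcFace_slant_vert_below (k j : ℤ) : arcFace (.slant (k - 1) j, .vert k (j - 1)) = some (k - 1, j - 1) := by
  have h : (MidEdge.slant (k - 1) j, MidEdge.vert k (j - 1)) =
      (Face.side (k - 1, j - 1) .N, Face.side (k - 1, j - 1) .E) := by
    simp [Face.side]
  rw [h]
  exact arcFace_side_side _ _ _ (by decide)

/-- The arc from the West to the North side of the rhombus `(k, j - 1)`. [folklore] -/
theorem arcFace_vert_slant_above (k j : ℤ) : arcFace (.vert k (j - 1), .slant k j) = some (k, j - 1) := by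
  have h : (MidEdge.vert k (j - 1), MidEdge.slant k j) = (Face.side (k, j - 1) .W, Face.side (k, j - 1) .N) := by
    simp [Face.side]
  rw [h]
  exact arcFace_side_side _ _ _ (by decide)

/-- The arc from the South to the West side of the rhombus `(k, j)`. [folklore] -/
theorem arcFace_slant_vert_self (k j : ℤ) : arcFace (.slant k j, .vert k j) = some (k, j) := by
  have h : (MidEdge.slant k j, MidEdge.vert k j) = (Face.side (k, j) .S, Face.side (k, j) .W) := rfl
  rw [h]
  exact arcFace_side_side _ _ _ (by decide)

/-- **The plaquette polygon around a vertex**: the smallest polygons of the whole-plane tiling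
surround one vertex — here the lower-left corner of the rhombus `v = (k, j)` — crossing the four
edges at it, counterclockwise from the vertical edge above the vertex:
`vert k j → slant (k-1) j → vert k (j-1) → slant k j`, with one arc in each of the four rhombi
`(k-1, j)`, `(k-1, j-1)`, `(k, j-1)`, `(k, j)` at the vertex (of kinds corner, co-corner, corner,
co-corner: weight `u₁u₂(θ_{k-1}) · u₁u₂(θ_k)`). In particular the type of polygons is nonempty.
[folklore] -/
def YBPolygon.plaquette (v : Face) : YBPolygon (Set.univ : Set Face) where
  mids := [.vert v.1 v.2, .slant (v.1 - 1) v.2, .vert v.1 (v.2 - 1), .slant v.1 v.2]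
  ne_nil := by simp
  nodup := by simp; omega
  arc_mem p hp := by
    simp only [cycPairs_four, List.mem_cons, List.not_mem_nil, or_false] at hp
    rcases hp with rfl | rfl | rfl | rfl
    · exact ⟨_, Set.mem_univ _, arcFace_vert_slant_left _ _⟩
    · exact ⟨_, Set.mem_univ _, arcFace_slant_vert_below _ _⟩
    · exact ⟨_, Set.mem_univ _, arcFace_vert_slant_above _ _⟩
    · exact ⟨_, Set.mem_univ _, arcFace_slant_vert_self _ _⟩
  chain q hq := by
    obtain ⟨k, j⟩ := v
    simp only [cycPairs_four, List.mem_cons, List.not_mem_nil, or_false] at hq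
    rcases hq with rfl | rfl | rfl | rfl <;>
      simp [arcFace_vert_slant_left, arcFace_slant_vert_below, arcFace_vert_slant_above,
        arcFace_slant_vert_self] <;> omega
  noncross f h := by
    exfalso
    simp [cycPairs_four, Face.side] at h

/-- Polygons of the whole-plane tiling exist. [folklore] -/
instance : Nonempty (YBPolygon (Set.univ : Set Face)) := ⟨YBPolygon.plaquette (0, 0)⟩

/-- The plaquette crosses four edges. [folklore] -/
@[simp] theorem YBPolygon.length_plaquette (v : Face) : (YBPolygon.plaquette v).length = 4 := rfl

end Plaquette

/-! ### The `2n` rooted oriented readings of a polygon: the fibres of `arcSet` -/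

namespace YBPolygon

variable {D : Set Face}

/-- Membership in the arc set. [folklore] -/
theorem mem_arcSet_iff (P : YBPolygon D) {a b : MidEdge} :
    s(a, b) ∈ P.arcSet ↔ (a, b) ∈ P.arcs ∨ (b, a) ∈ P.arcs := by
  simp only [arcSet, List.mem_toFinset, List.mem_map, Sym2.eq_iff]
  constructor
  · rintro ⟨⟨c, d⟩, hp, ⟨rfl, rfl⟩ | ⟨rfl, rfl⟩⟩
    · exact Or.inl hp
    · exact Or.inr hp
  · rintro (h | h)
    · exact ⟨(a, b), h, Or.inl ⟨rfl, rfl⟩⟩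
    · exact ⟨(b, a), h, Or.inr ⟨rfl, rfl⟩⟩

/-- A mid-edge belongs to a polygon iff it is an end of one of its (unordered) arcs. [folklore] -/
theorem mem_mids_iff_exists_mem_arcSet (P : YBPolygon D) {a : MidEdge} :
    a ∈ P.mids ↔ ∃ b, s(a, b) ∈ P.arcSet := by
  constructor
  · intro ha
    obtain ⟨p, hp, rfl⟩ := exists_mem_cycPairs_fst_eq ha
    exact ⟨p.2, P.mem_arcSet_iff.2 (Or.inl hp)⟩
  · rintro ⟨b, hb⟩
    rcases P.mem_arcSet_iff.1 hb with h | h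
    · exact (mem_of_mem_cycPairs h).1
    · exact (mem_of_mem_cycPairs h).2

/-- Polygons with the same arc set cross the same mid-edges. [folklore] -/
theorem toFinset_mids_eq_of_arcSet_eq {P Q : YBPolygon D} (hA : Q.arcSet = P.arcSet) :
    Q.mids.toFinset = P.mids.toFinset := by
  ext a
  rw [List.mem_toFinset, List.mem_toFinset, Q.mem_mids_iff_exists_mem_arcSet,
    P.mem_mids_iff_exists_mem_arcSet, hA]

/-- Polygons with the same arc set have the same number of mid-edges. [folklore] -/
theorem length_eq_of_arcSet_eq {P Q : YBPolygon D} (hA : Q.arcSet = P.arcSet) :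
    Q.mids.length = P.mids.length := by
  rw [← List.toFinset_card_of_nodup Q.nodup, ← List.toFinset_card_of_nodup P.nodup,
    toFinset_mids_eq_of_arcSet_eq hA]

/-- **The arc leaving the `i`-th mid-edge goes to the `(i+1)`-st** (indices mod `n`). [folklore] -/
theorem mk_mem_arcs_iff (P : YBPolygon D) {i : ℕ} (hi : i < P.mids.length) {b : MidEdge} :
    (P.mids[i], b) ∈ P.arcs ↔ b = P.mids[(i + 1) % P.mids.length]'(Nat.mod_lt _ P.length_pos) := by
  rw [arcs, mem_cycPairs_iff]
  constructor
  · rintro ⟨j, hj, h1, h2⟩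
    have hij : j = i := (P.nodup.getElem_inj_iff).1 h1
    subst hij
    exact h2.symm
  · intro h
    exact ⟨i, hi, rfl, h.symm⟩

/-- **The arc arriving at the `i`-th mid-edge comes from the `(i-1)`-st** (indices mod `n`).
[folklore] -/
theorem mk_mem_arcs_iff' (P : YBPolygon D) {i : ℕ} (hi : i < P.mids.length) {a : MidEdge} :
    (a, P.mids[i]) ∈ P.arcs ↔ a = P.mids[(i + P.mids.length - 1) % P.mids.length]'(Nat.mod_lt _ P.length_pos) := by
  rw [arcs, mem_cycPairs_iff]
  constructor
  · rintro ⟨j, hj, h1, h2⟩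
    have hij : (j + 1) % P.mids.length = i := (P.nodup.getElem_inj_iff).1 h2
    have hidx : (i + P.mids.length - 1) % P.mids.length = j := by
      rcases Nat.lt_or_ge (j + 1) P.mids.length with hj1 | hj1
      · rw [Nat.mod_eq_of_lt hj1] at hij
        rw [← hij, show j + 1 + P.mids.length - 1 = j + P.mids.length by omega, Nat.add_mod_right]
        exact Nat.mod_eq_of_lt hj
      · have hj' : j + 1 = P.mids.length := by omega
        rw [hj', Nat.mod_self] at hij
        rw [← hij, show 0 + P.mids.length - 1 = j by omega]
        exact Nat.mod_eq_of_lt hj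
    simp only [hidx]
    exact h1.symm
  · intro h
    refine ⟨(i + P.mids.length - 1) % P.mids.length, Nat.mod_lt _ P.length_pos, h.symm, ?_⟩
    have hidx : ((i + P.mids.length - 1) % P.mids.length + 1) % P.mids.length = i := by
      rw [Nat.mod_add_mod, show i + P.mids.length - 1 + 1 = i + P.mids.length by omega, Nat.add_mod_right]
      exact Nat.mod_eq_of_lt hi
    simp only [hidx]

/-- A polygon crosses at least two edges. [folklore] -/
theorem one_lt_length (P : YBPolygon D) : 1 < P.mids.length := lt_of_lt_of_le (by norm_num) P.three_le_length

/-- **Unique continuation**: two polygons with the same arc set which are read from the same root in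
the same direction (same first two mid-edges) are the same rooted oriented polygon. [folklore] -/
theorem mids_eq_of_arcSet_eq {P Q : YBPolygon D} (hA : Q.arcSet = P.arcSet)
    (h0 : Q.mids[0]'Q.length_pos = P.mids[0]'P.length_pos)
    (h1 : Q.mids[1]'Q.one_lt_length = P.mids[1]'P.one_lt_length) :
    Q.mids = P.mids := by
  have hn : Q.mids.length = P.mids.length := length_eq_of_arcSet_eq hA
  have key : ∀ (i : ℕ) (hi : i + 1 < P.mids.length),
      Q.mids[i]'(by omega) = P.mids[i] ∧ Q.mids[i + 1]'(by omega) = P.mids[i + 1] := by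
    intro i
    induction i with
    | zero => exact fun _ => ⟨h0, h1⟩
    | succ i ih =>
      intro hi
      obtain ⟨e0, e1⟩ := ih (by omega)
      refine ⟨e1, ?_⟩
      have hq : (Q.mids[i + 1]'(by omega), Q.mids[i + 1 + 1]'(by omega)) ∈ Q.arcs := by
        rw [arcs, mem_cycPairs_iff]
        refine ⟨i + 1, by omega, rfl, ?_⟩
        have : (i + 1 + 1) % Q.mids.length = i + 1 + 1 := Nat.mod_eq_of_lt (by omega)
        simp only [this]
      have hs : s(Q.mids[i + 1]'(by omega), Q.mids[i + 1 + 1]'(by omega)) ∈ P.arcSet :=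
        hA ▸ Q.mem_arcSet_iff.2 (Or.inl hq)
      simp only [e1] at hs
      rcases P.mem_arcSet_iff.1 hs with h | h
      · rw [P.mk_mem_arcs_iff (by omega)] at h
        have : (i + 1 + 1) % P.mids.length = i + 1 + 1 := Nat.mod_eq_of_lt (by omega)
        simp only [this] at h
        exact h
      · rw [P.mk_mem_arcs_iff' (by omega)] at h
        have hidx : (i + 1 + P.mids.length - 1) % P.mids.length = i := by
          rw [show i + 1 + P.mids.length - 1 = i + P.mids.length by omega, Nat.add_mod_right]
          exact Nat.mod_eq_of_lt (by omega)
        simp only [hidx] at h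
        rw [← e0] at h
        have := (Q.nodup.getElem_inj_iff).1 h
        omega
  apply List.ext_getElem hn
  intro i h₁ h₂
  rcases Nat.eq_zero_or_pos i with rfl | hpos
  · exact h0
  · obtain ⟨i, rfl⟩ : ∃ j, i = j + 1 := ⟨i - 1, by omega⟩
    exact (key i h₂).2

/-- **The rooted oriented readings of a polygon.** Two rooted oriented polygons have the same arc
set iff one is obtained from the other by a change of root, possibly after reversal. [folklore] -/
theorem arcSet_eq_iff {P Q : YBPolygon D} :
    Q.arcSet = P.arcSet ↔ ∃ k < P.mids.length, Q = P.rotate k ∨ Q = P.reverse.rotate k := by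
  constructor
  · intro hA
    have hn : Q.mids.length = P.mids.length := length_eq_of_arcSet_eq hA
    have h3P := P.three_le_length
    have h3Q := Q.three_le_length
    simp only [length] at h3P h3Q
    have hq0 : Q.mids[0]'Q.length_pos ∈ P.mids := by
      rw [← List.mem_toFinset, ← toFinset_mids_eq_of_arcSet_eq hA, List.mem_toFinset]
      exact List.getElem_mem _
    obtain ⟨j, hj, hj0⟩ := List.mem_iff_getElem.1 hq0
    have h01 : (Q.mids[0]'Q.length_pos, Q.mids[1]'(by omega)) ∈ Q.arcs := by
      rw [arcs, mem_cycPairs_iff]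
      refine ⟨0, Q.length_pos, rfl, ?_⟩
      have : (0 + 1) % Q.mids.length = 1 := Nat.mod_eq_of_lt (by omega)
      simp only [this]
    have hs : s(P.mids[j], Q.mids[1]'(by omega)) ∈ P.arcSet := by
      rw [hj0, ← hA]
      exact Q.mem_arcSet_iff.2 (Or.inl h01)
    rcases P.mem_arcSet_iff.1 hs with h | h
    · -- `Q` reads `P` forwards from the `j`-th mid-edge
      rw [P.mk_mem_arcs_iff hj] at h
      refine ⟨j, hj, Or.inl (YBPolygon.ext ?_)⟩
      refine mids_eq_of_arcSet_eq (P := P.rotate j) (by simpa using hA) ?_ ?_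
      · simp only [mids_rotate, List.getElem_rotate, Nat.zero_add, Nat.mod_eq_of_lt hj]
        exact hj0.symm
      · simp only [mids_rotate, List.getElem_rotate, Nat.add_comm 1 j]
        exact h
    · -- `Q` reads `P` backwards from the `j`-th mid-edge
      rw [P.mk_mem_arcs_iff' hj] at h
      refine ⟨P.mids.length - 1 - j, by omega, Or.inr (YBPolygon.ext ?_)⟩
      refine mids_eq_of_arcSet_eq (P := P.reverse.rotate (P.mids.length - 1 - j)) (by simpa using hA) ?_ ?_
      · simp only [mids_rotate, mids_reverse, List.getElem_rotate, List.length_reverse, Nat.zero_add,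
          Nat.mod_eq_of_lt (show P.mids.length - 1 - j < P.mids.length by omega), List.getElem_reverse]
        rw [← hj0]
        congr 1
        omega
      · simp only [mids_rotate, mids_reverse, List.getElem_rotate, List.length_reverse, List.getElem_reverse]
        rw [h]
        rcases Nat.eq_zero_or_pos j with rfl | hjpos
        · have e1 : (1 + (P.mids.length - 1 - 0)) % P.mids.length = 0 := by
            rw [show 1 + (P.mids.length - 1 - 0) = P.mids.length by omega, Nat.mod_self]
          have e2 : (0 + P.mids.length - 1) % P.mids.length = P.mids.length - 1 := by
            rw [show 0 + P.mids.length - 1 = P.mids.length - 1 by omega]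
            exact Nat.mod_eq_of_lt (by omega)
          simp only [e1, e2]
          congr 1
        · have e1 : (1 + (P.mids.length - 1 - j)) % P.mids.length = P.mids.length - j := by
            rw [show 1 + (P.mids.length - 1 - j) = P.mids.length - j by omega]
            exact Nat.mod_eq_of_lt (by omega)
          have e2 : (j + P.mids.length - 1) % P.mids.length = j - 1 := by
            rw [show j + P.mids.length - 1 = (j - 1) + P.mids.length by omega, Nat.add_mod_right]
            exact Nat.mod_eq_of_lt (by omega)
          simp only [e1, e2]
          congr 1
          omega
  · rintro ⟨k, -, rfl | rfl⟩ <;> simp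

/-- Re-rooting a polygon by `k < n` different amounts gives different rooted polygons (no
nontrivial rotation fixes a list without repetitions). [folklore] -/
theorem rotate_injOn (P : YBPolygon D) :
    Set.InjOn (fun k => P.rotate k) {k | k < P.mids.length} := by
  intro k hk l hl h
  have h' := P.nodup.rotate_congr P.ne_nil k l (congrArg YBPolygon.mids h)
  rwa [Nat.mod_eq_of_lt (show k < P.mids.length from hk), Nat.mod_eq_of_lt (show l < P.mids.length from hl)] at h'

/-- **A reading of a polygon is never a reading of its reversal**: a list of `n ≥ 3` distinct
entries is not a rotation of its reverse. [folklore] -/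
theorem rotate_ne_reverse_rotate (P : YBPolygon D) (k l : ℕ) : P.rotate k ≠ P.reverse.rotate l := by
  intro h
  have h3 : 3 ≤ P.mids.length := P.three_le_length
  have hpos : 0 < P.mids.length := P.length_pos
  have hmids : P.mids.rotate k = P.mids.reverse.rotate l := congrArg YBPolygon.mids h
  -- `P.mids.reverse` is a rotation of `P.mids`
  have hrev : P.mids.reverse = P.mids.rotate (k + (P.mids.length * l - l)) := by
    have h1 : (P.mids.reverse.rotate l).rotate (P.mids.length * l - l) = P.mids.reverse := by
      rw [List.rotate_rotate]
      have : l + (P.mids.length * l - l) = P.mids.reverse.length * l := by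
        rw [List.length_reverse]
        have := Nat.le_mul_of_pos_left l hpos
        omega
      rw [this, List.rotate_length_mul]
    rw [← h1, ← hmids, List.rotate_rotate]
  -- compare the first two entries: `zₙ₋₁ = z_m`, `zₙ₋₂ = z_{m+1}` force `n ≤ 2`
  have e0 := List.getElem_of_eq hrev (show 0 < P.mids.reverse.length by simp only [List.length_reverse]; omega)
  have e1 := List.getElem_of_eq hrev (show 1 < P.mids.reverse.length by simp only [List.length_reverse]; omega)
  simp only [List.getElem_reverse, List.getElem_rotate, P.nodup.getElem_inj_iff, Nat.zero_add,
    Nat.sub_zero] at e0 e1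
  rw [← Nat.add_mod_mod, ← e0, show 1 + (P.mids.length - 1) = P.mids.length by omega, Nat.mod_self] at e1
  omega

/-- Equality of rooted polygons is equality of their lists of mid-edges. [folklore] -/
instance : DecidableEq (YBPolygon D) := fun _ _ => decidable_of_iff _ YBPolygon.ext_iff.symm

/-- The `2n` rooted oriented readings of a polygon, as a finite set. [folklore] -/
def readings (P : YBPolygon D) : Finset (YBPolygon D) :=
  (Finset.range P.mids.length).image (fun k => P.rotate k) ∪
    (Finset.range P.mids.length).image (fun k => P.reverse.rotate k)

/-- The readings of `P` are exactly the rooted oriented polygons with the arc set of `P`.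
[folklore] -/
theorem mem_readings_iff {P Q : YBPolygon D} : Q ∈ P.readings ↔ Q.arcSet = P.arcSet := by
  rw [arcSet_eq_iff, readings, Finset.mem_union, Finset.mem_image, Finset.mem_image]
  constructor
  · rintro (⟨k, hk, rfl⟩ | ⟨k, hk, rfl⟩)
    · exact ⟨k, Finset.mem_range.1 hk, Or.inl rfl⟩
    · exact ⟨k, Finset.mem_range.1 hk, Or.inr rfl⟩
  · rintro ⟨k, hk, rfl | rfl⟩
    · exact Or.inl ⟨k, Finset.mem_range.2 hk, rfl⟩
    · exact Or.inr ⟨k, Finset.mem_range.2 hk, rfl⟩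

/-- The fibre of `arcSet` through `P` is the set of readings of `P`. [folklore] -/
theorem arcSet_preimage_singleton (P : YBPolygon D) :
    arcSet ⁻¹' {P.arcSet} = (P.readings : Set (YBPolygon D)) := by
  ext Q
  rw [Set.mem_preimage, Set.mem_singleton_iff, Finset.mem_coe, mem_readings_iff]

/-- **A polygon with `n` mid-edges has exactly `2n` rooted oriented readings.** [folklore] -/
theorem card_readings (P : YBPolygon D) : P.readings.card = 2 * P.mids.length := by
  rw [readings, Finset.card_union_of_disjoint, Finset.card_image_of_injOn, Finset.card_image_of_injOn,
    Finset.card_range, two_mul]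
  · intro k hk l hl h
    have h' : P.reverse.rotate k = P.reverse.rotate l := h
    exact P.reverse.rotate_injOn (by simpa using hk) (by simpa using hl) h'
  · intro k hk l hl h
    exact P.rotate_injOn (by simpa using hk) (by simpa using hl) h
  · rw [Finset.disjoint_left]
    rintro Q hQ hQ'
    rw [Finset.mem_image] at hQ hQ'
    obtain ⟨k, -, rfl⟩ := hQ
    obtain ⟨l, -, h⟩ := hQ'
    exact P.rotate_ne_reverse_rotate k l h.symm

/-- All readings of a polygon have the same mass. [folklore] -/
theorem mass_eq_of_mem_readings (Θ : ℤ → ℝ) (x : ℝ) {P Q : YBPolygon D} (hQ : Q ∈ P.readings) :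
    Q.mass Θ x = P.mass Θ x := by
  rw [mem_readings_iff, arcSet_eq_iff] at hQ
  obtain ⟨k, -, rfl | rfl⟩ := hQ <;> simp

end YBPolygon

/-- **The polygon measure gives mass `w_Θ(P) x^{|P|}` to each polygon**: the `2n` rooted oriented
readings of a polygon with `n` mid-edges, of mass `w x^{|P|}/(2n)` each, make up its `ν`-mass.
[cite: Glazman2015WeightedSAW, §5; Werner2008SelfAvoidingLoops, §7.1] -/
theorem ybPolygonMeasure_singleton_arcSet {D : Set Face} (Θ : ℤ → ℝ) (x : ℝ) (P : YBPolygon D) :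
    ybPolygonMeasure Θ D x {P.arcSet} = ENNReal.ofReal (P.weight Θ * x ^ P.totalLength Θ) := by
  rw [ybPolygonMeasure_apply Θ x (measurableSet_singleton _), P.arcSet_preimage_singleton,
    ybRootedPolygonMeasure_apply, ← sum_eq_tsum_indicator,
    Finset.sum_congr rfl fun Q hQ => YBPolygon.mass_eq_of_mem_readings Θ x hQ, Finset.sum_const,
    P.card_readings, nsmul_eq_mul, ← P.two_mul_length_mul_mass Θ x]
  push_cast
  ring

/-- The polygon measure of a single arc set: `w_Θ x^{|P|}` for the arc set of a polygon `P`, and `0`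
otherwise. [folklore] -/
theorem ybPolygonMeasure_singleton_of_not {D : Set Face} (Θ : ℤ → ℝ) (x : ℝ) {A : Finset (Sym2 MidEdge)}
    (hA : ¬IsYBPolygonArcSet D A) : ybPolygonMeasure Θ D x {A} = 0 :=
  measure_mono_null (fun B hB => by rw [Set.mem_singleton_iff.1 hB]; exact hA)
    (ybPolygonMeasure_not_isYBPolygonArcSet Θ x)

/-! ### Cutting a rooted polygon open: the underlying self-avoiding walk -/

section Cut

/-- The (open) arcs of a list (`arcsOf = consecPairs`) are among its cyclic arcs. [folklore] -/
theorem mem_cycPairs_of_mem_arcsOf {l : List MidEdge} {p : MidEdge × MidEdge} (hp : p ∈ arcsOf l) :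
    p ∈ cycPairs l :=
  consecPairs_subset_cycPairs l hp

/-- The `i`-th open arc of a list. [folklore] -/
theorem getElem_arcsOf (l : List MidEdge) {i : ℕ} (hi : i < (arcsOf l).length) :
    (arcsOf l)[i] = (l[i]'(by simp [arcsOf, List.length_zip] at hi; omega),
      l[i + 1]'(by simp [arcsOf, List.length_zip] at hi; omega)) := by
  simp [arcsOf, List.getElem_zip, List.getElem_tail]

namespace YBPolygon

variable {D : Set Face}

/-- **Cutting a rooted polygon open at its root** gives a self-avoiding walk of the Yang–Baxter
model (`YBWalk`) from the root `z₀` to the last mid-edge `zₙ₋₁`, with all the arcs of the polygon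
but the closing one `zₙ₋₁ → z₀` (the first step of the cutting identities relating the polygon
measure to two-point functions). [folklore] -/
def toWalk (P : YBPolygon D) : YBWalk D P.root (P.mids.getLast P.ne_nil) where
  mids := P.mids
  head_eq := List.head?_eq_some_head P.ne_nil
  getLast_eq := List.getLast?_eq_some_getLast P.ne_nil
  nodup := P.nodup
  arc_mem p hp := P.arc_mem p (mem_cycPairs_of_mem_arcsOf hp)
  isChain := by
    rw [List.isChain_iff_getElem]
    intro i hi
    have hn : i + 2 < P.mids.length := by simp [arcsOf, List.length_zip] at hi; omega
    rw [getElem_arcsOf, getElem_arcsOf]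
    refine P.chain ((P.mids[i], P.mids[i + 1]), (P.mids[i + 1], P.mids[i + 1 + 1]))
      (mem_cycPairs_iff.2 ⟨i, by simp; omega, ?_, ?_⟩)
    · simp only [getElem_cycPairs, Prod.mk.injEq, true_and]
      have e2 : (i + 1) % P.mids.length = i + 1 := Nat.mod_eq_of_lt (by omega)
      simp only [e2]
    · have e1 : (i + 1) % (cycPairs P.mids).length = i + 1 := by
        rw [length_cycPairs]; exact Nat.mod_eq_of_lt (by omega)
      simp only [e1, getElem_cycPairs, Prod.mk.injEq, true_and]
      have e3 : (i + 1 + 1) % P.mids.length = i + 1 + 1 := Nat.mod_eq_of_lt (by omega)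
      simp only [e3]
  noncross f h := by
    have h' := P.noncross f (h.imp mem_cycPairs_of_mem_arcsOf mem_cycPairs_of_mem_arcsOf)
    exact fun h'' => h' (h''.imp mem_cycPairs_of_mem_arcsOf mem_cycPairs_of_mem_arcsOf)

/-- The cut walk crosses the same mid-edges as the polygon. [folklore] -/
@[simp] theorem mids_toWalk (P : YBPolygon D) : P.toWalk.mids = P.mids := rfl

end YBPolygon

end Cut

end Literature.Probability.RandomPlanarGeometry.SAW.YangBaxter
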